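import Literature.Barriers.Schanuel.NesterenkoModularScopeMahlerBridge
import Literature.Barriers.Schanuel.NesterenkoModularScopeMahlerLimit
import Literature.Barriers.Schanuel.NesterenkoModularScopeMahlerAlgebra
import Literature.Barriers.Schanuel.NesterenkoModularScopeLemma52Proofs
import Literature.NumberTheory.EllipticCurves.ModularFormsRamanujan
import Mathlib.Algebra.MvPolynomial.Division
import Mathlib.Topology.Algebra.MvPolynomial
import HarnessLib

/-!
# Barrier (Schanuel) `NesterenkoModularScope`: Mahler's theorem (`z, P, Q, R` algebraically independent) — proofs only

`Literature/Barriers/Schanuel/NesterenkoModularScopeMahlerProofs.lean` — proofs-only sibling of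
`NesterenkoModularScopeMultiplicity.lean`. No new definitions, nothing asserted. It DISCHARGES the
named fact

* `Mahler1969_ramanujan_algIndep_holds : Mahler1969_ramanujan_algIndep` — **Mahler's theorem** as
  the book uses it (LNM 1752 Ch. 3 §3 property 3), Ch. 10 §5): for every non-zero
  `A ∈ ℂ[z, x₁, x₂, x₃]` the formal composite `A(z, P(z), Q(z), R(z)) ∈ ℂ⟦z⟧` is non-zero,

and with it (through `ch10_lemma_5_2_of_mahler`, `NesterenkoModularScopeLemma52Proofs.lean`)

* `NesterenkoPhilippon2001_ch10_lemma_5_2_holds` — LNM 1752 Ch. 10 Lemma 5.2 (the only non-zero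
  principal prime `D`-stable ideals of `ℂ[z, x₁, x₂, x₃]` are `(z)` and `(Δ)`).

On the way: `eq_zero_of_forall_aeval_E₄_E₆_eq_zero` (`E₄, E₆` algebraically independent over `ℂ`)
and `eq_zero_of_forall_aeval_E2_E₄_E₆_eq_zero` (`E₂, E₄, E₆` algebraically independent over `ℂ`,
[NesterenkoPhilippon2001, Ch. 1 Prop. 1.1 iii)]).

## The printed argument and the proof given here

Mahler [Mahler1969, Thm 1] proves the algebraic independence of `ω, e^{cω}, f, f', f″` for a
modular function `f`; the book (Ch. 10 p. 163, Ch. 3 p. 32) quotes the consequence for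
`q = e^{2πiτ}, P = E₂, Q = E₄, R = E₆`, and Ch. 1 Prop. 1.1 iii) records the "standard weight
argument". We formalise that weight argument directly for `(q, E₂, E₄, E₆)`:

1. *Bridge.* A formal relation `A(z, P, Q, R) = 0` gives `A(e^{2πiτ}, E₂(τ), E₄(τ), E₆(τ)) = 0` on
   `ℍ` (`NesterenkoModularScopeMahlerBridge.lean`).
2. *Isobaric reduction* (`eval_weightedHomogeneousComponent_top_eq_zero_of_tendsto`). Give
   `z, x₁, x₂, x₃` the weights `0, 1, 2, 3`. For `γ_r = [[1, r], [n, 1 + rn]] ∈ SL₂(ℤ)` one has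
   `J_r = nτ + 1 + rn → ∞`, `γ_r τ → 1/n`, and `E₂(γ_r τ) = J_r²(E₂(τ) + Kn/J_r)`,
   `E₄(γ_r τ) = J_r⁴ E₄(τ)`, `E₆(γ_r τ) = J_r⁶ E₆(τ)` (`NesterenkoModularScopeMahlerLimit.lean`), so
   `0 = A(pt(γ_r τ)) = Σ_m J_r^{2m} A_m(x_r)` with `x_r → (e^{2πi/n}, E₂(τ), E₄(τ), E₆(τ))`; the limit
   lemma (divide by the top power of `J_r`, let `r → ∞`) gives `A_W(e^{2πi/n}, E₂, E₄, E₆) ≡ 0` for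
   the top isobaric component `A_W ≠ 0` and every `n ≥ 1`.
3. *The variable `z`.* For fixed `τ` the polynomial `A_W(·, E₂(τ), E₄(τ), E₆(τ))` has the
   infinitely many roots `e^{2πi/n}`, so all its coefficients — polynomials in `E₂, E₄, E₆` —
   vanish on `ℍ`.
4. *`E₂, E₄, E₆` are algebraically independent.* Reduce to an isobaric `B` (weights `1, 2, 3`) by
   step 2; then `B(E₂(γτ), E₄(γτ), E₆(γτ)) = J^{2W} B(E₂(τ) + Kc/J, E₄(τ), E₆(τ))`, and the matrices
   `[[1, d − 1], [1, d]]` give the infinitely many shifts `K/(τ + d)`, `d ∈ ℤ` (`K ≠ 0`): the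
   coefficients of `B` as a polynomial in `x₁` vanish on `(E₄, E₆)`.
5. *`E₄, E₆` are algebraically independent.* Reduce to an isobaric `F` (weights `2, 3`); write
   `F = x·F₁ + F₀` with `F₀ ∈ ℂ[y]` isobaric, i.e. `F₀ = c·y^{W/3}`; at `τ = ρ`, `E₄(ρ) = 0 ≠ E₆(ρ)`
   (`ModularFormsRamanujan.lean`) forces `c = 0`; then `E₄ · F₁(E₄, E₆) ≡ 0`, which through the
   bridge is the formal identity `Q · F₁(Q, R) = 0` in the domain `ℂ⟦q⟧`, so `F₁(E₄, E₆) ≡ 0` with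
   `F₁` isobaric of weight `W − 2`: induction on `W`.

## References

* [Mahler1969] K. Mahler, *On algebraic differential equations satisfied by automorphic
  functions*, J. Austral. Math. Soc. 10 (1969) 445–450, Theorem 1 and its proof.
* [NesterenkoPhilippon2001] Yu. V. Nesterenko, P. Philippon (eds.), *Introduction to Algebraic
  Independence Theory*, LNM 1752, Springer 2001: Ch. 1 §1 (1) and Prop. 1.1 iii) (p. 2–3);
  Ch. 3 §1 (p. 27), §3 property 3) (p. 32); Ch. 10 §1 Example 3 (p. 151), §5 Lemma 5.2 (pp. 162–163).
-/

noncomputable section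

open UpperHalfPlane hiding I
open Filter Topology Complex ModularForm EisensteinSeries ModularGroup MvPolynomial
open scoped Real MatrixGroups

namespace Literature.Barriers.Schanuel

/-! ### The isobaric reduction (Mahler's device) -/

/-- **Isobaric reduction.** If `A(J_r^{w_i} x_{r,i}) = 0` for all `r`, `‖J_r‖ → ∞` and `x_r → L`,
then the top isobaric component of `A` vanishes at `L`.
[cite: Mahler1969, proof of Theorem 1 (division by `(γ_r ω + δ_r)^N`, `r → ∞`)] -/
theorem eval_weightedHomogeneousComponent_top_eq_zero_of_tendsto {σ : Type*} (w : σ → ℕ)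
    (A : MvPolynomial σ ℂ) {J : ℕ → ℂ} (hJ : Tendsto (fun r => ‖J r‖) atTop atTop)
    {x : ℕ → σ → ℂ} {L : σ → ℂ} (hx : Tendsto x atTop (𝓝 L))
    (h : ∀ r, eval (fun i => J r ^ w i * x r i) A = 0) :
    eval L (weightedHomogeneousComponent w (A.weightedTotalDegree w) A) = 0 := by
  refine eq_zero_of_sum_pow_mul_tendsto (W := A.weightedTotalDegree w) hJ
    (F := fun m r => eval (x r) (weightedHomogeneousComponent w m A))
    (L := fun m => eval L (weightedHomogeneousComponent w m A)) ?_ ?_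
  · intro m _
    exact ((MvPolynomial.continuous_eval _).tendsto L).comp hx
  · intro r
    rw [← eval_scale_eq_sum]
    exact h r

/-- If `f ∈ ℂ[x₀, …, xₙ]` vanishes at `(y, s)` for infinitely many `y` (fixed `s`), then every
coefficient of `f`, as a polynomial in `x₀`, vanishes at `s`. [folklore] -/
theorem eval_coeff_finSuccEquiv_eq_zero {n : ℕ} (f : MvPolynomial (Fin (n + 1)) ℂ) (s : Fin n → ℂ)
    (S : Set ℂ) (hS : S.Infinite) (h : ∀ y ∈ S, eval (Fin.cons y s : Fin (n + 1) → ℂ) f = 0) (k : ℕ) :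
    eval s ((finSuccEquiv ℂ n f).coeff k) = 0 := by
  set p : Polynomial ℂ := Polynomial.map (eval s) (finSuccEquiv ℂ n f) with hp
  have hp0 : p = 0 := by
    apply Polynomial.eq_zero_of_infinite_isRoot
    refine hS.mono ?_
    intro y hy
    simp only [Set.mem_setOf_eq, Polynomial.IsRoot.def]
    rw [hp, ← MvPolynomial.eval_eq_eval_mv_eval']
    exact h y hy
  have := congrArg (fun q : Polynomial ℂ => q.coeff k) hp0
  simpa only [hp, Polynomial.coeff_map, Polynomial.coeff_zero] using this

/-- A polynomial all of whose `x₀`-coefficients vanish is zero. [folklore] -/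
theorem eq_zero_of_forall_coeff_finSuccEquiv_eq_zero {R : Type*} [CommSemiring R] {n : ℕ}
    {f : MvPolynomial (Fin (n + 1)) R} (h : ∀ k, (finSuccEquiv R n f).coeff k = 0) : f = 0 := by
  have h0 : finSuccEquiv R n f = 0 := Polynomial.ext fun k => by rw [h k, Polynomial.coeff_zero]
  exact (finSuccEquiv R n).injective (by rw [h0, map_zero])

/-! ### The points `(E₄, E₆)`, `(E₂, E₄, E₆)`, `(q, E₂, E₄, E₆)` under `SL₂(ℤ)`

Throughout, `K = −2πi/(2ζ(2))` (written out) is the constant of `E2_smul`: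
`E₂(γτ) = (cτ+d)²E₂(τ) + Kc(cτ+d)`, `K ≠ 0` (`mahler_K_ne_zero`). -/

/-- `(E₄(γτ), E₆(γτ)) = ((J²)² E₄(τ), (J²)³ E₆(τ))`, `J = cτ + d`. [folklore] -/
theorem mahler_pt2_smul (γ : SL(2, ℤ)) (τ : ℍ) :
    (![E₄ (γ • τ), E₆ (γ • τ)] : Fin 2 → ℂ) =
      fun i => ((denom γ τ) ^ 2) ^ ((![2, 3] : Fin 2 → ℕ) i) * (![E₄ τ, E₆ τ] : Fin 2 → ℂ) i := by
  have h4 : E₄ (γ • τ) = ((denom γ τ) ^ 2) ^ 2 * E₄ τ := by rw [E₄_slash_smul]; ring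
  have h6 : E₆ (γ • τ) = ((denom γ τ) ^ 2) ^ 3 * E₆ τ := by rw [E₆_slash_smul]; ring
  funext i
  fin_cases i
  · exact h4
  · exact h6

/-- `(E₂(γτ), E₄(γτ), E₆(γτ)) = (J²(E₂(τ) + Kc/J), (J²)² E₄(τ), (J²)³ E₆(τ))`.
[cite: NesterenkoPhilippon2001, Ch. 1 §1 (1)] -/
theorem mahler_pt3_smul (γ : SL(2, ℤ)) (τ : ℍ) :
    (![E2 (γ • τ), E₄ (γ • τ), E₆ (γ • τ)] : Fin 3 → ℂ) =
      fun i => ((denom γ τ) ^ 2) ^ ((![1, 2, 3] : Fin 3 → ℕ) i) *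
        (![E2 τ + (-(2 * (π : ℂ) * Complex.I) / (2 * riemannZeta 2)) * ((γ 1 0 : ℤ) : ℂ) / denom γ τ,
          E₄ τ, E₆ τ] : Fin 3 → ℂ) i := by
  have hJ : denom γ τ ≠ 0 := denom_ne_zero _ _
  have h2 : E2 (γ • τ) =
      ((denom γ τ) ^ 2) ^ 1 * (E2 τ + (-(2 * (π : ℂ) * Complex.I) / (2 * riemannZeta 2)) * ((γ 1 0 : ℤ) : ℂ) / denom γ τ) := by
    rw [E2_smul]
    field_simp
  have h4 : E₄ (γ • τ) = ((denom γ τ) ^ 2) ^ 2 * E₄ τ := by rw [E₄_slash_smul]; ring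
  have h6 : E₆ (γ • τ) = ((denom γ τ) ^ 2) ^ 3 * E₆ τ := by rw [E₆_slash_smul]; ring
  funext i
  fin_cases i
  · exact h2
  · exact h4
  · exact h6

/-- `(q(γτ), E₂(γτ), E₄(γτ), E₆(γτ)) = ((J²)⁰ q(γτ), J²(E₂(τ) + Kc/J), (J²)² E₄(τ), (J²)³ E₆(τ))`.
[cite: NesterenkoPhilippon2001, Ch. 1 §1 (1)] -/
theorem mahler_pt4_smul (γ : SL(2, ℤ)) (τ : ℍ) :
    (![cexp (2 * π * Complex.I * (↑(γ • τ) : ℂ)), E2 (γ • τ), E₄ (γ • τ), E₆ (γ • τ)] : Fin 4 → ℂ) =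
      fun i => ((denom γ τ) ^ 2) ^ ((![0, 1, 2, 3] : Fin 4 → ℕ) i) *
        (![cexp (2 * π * Complex.I * (↑(γ • τ) : ℂ)),
          E2 τ + (-(2 * (π : ℂ) * Complex.I) / (2 * riemannZeta 2)) * ((γ 1 0 : ℤ) : ℂ) / denom γ τ,
          E₄ τ, E₆ τ] : Fin 4 → ℂ) i := by
  have hJ : denom γ τ ≠ 0 := denom_ne_zero _ _
  have h0 : cexp (2 * π * Complex.I * (↑(γ • τ) : ℂ)) =
      ((denom γ τ) ^ 2) ^ 0 * cexp (2 * π * Complex.I * (↑(γ • τ) : ℂ)) := by ring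
  have h2 : E2 (γ • τ) =
      ((denom γ τ) ^ 2) ^ 1 * (E2 τ + (-(2 * (π : ℂ) * Complex.I) / (2 * riemannZeta 2)) * ((γ 1 0 : ℤ) : ℂ) / denom γ τ) := by
    rw [E2_smul]
    field_simp
  have h4 : E₄ (γ • τ) = ((denom γ τ) ^ 2) ^ 2 * E₄ τ := by rw [E₄_slash_smul]; ring
  have h6 : E₆ (γ • τ) = ((denom γ τ) ^ 2) ^ 3 * E₆ τ := by rw [E₆_slash_smul]; ring
  funext i
  fin_cases i
  · exact h0
  · exact h2
  · exact h4
  · exact h6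

/-- `‖J_r²‖ → ∞` for `J_r = nτ + 1 + rn`, `n ≥ 1`. [folklore] -/
theorem tendsto_norm_denom_seq_sq {n : ℕ} (hn : 1 ≤ n) (τ : ℍ) :
    Tendsto (fun r : ℕ => ‖((n : ℂ) * τ + (1 + (r : ℂ) * n)) ^ 2‖) atTop atTop := by
  have h := (tendsto_pow_atTop two_ne_zero).comp (tendsto_norm_denom_seq hn τ)
  refine h.congr fun r => ?_
  simp [norm_pow]

/-- `E₂(τ) + Kn/J_r → E₂(τ)`. [folklore] -/
theorem tendsto_E2_add_div_denom_seq {n : ℕ} (hn : 1 ≤ n) (τ : ℍ) :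
    Tendsto (fun r : ℕ =>
      E2 τ + (-(2 * (π : ℂ) * Complex.I) / (2 * riemannZeta 2)) * (n : ℂ) / ((n : ℂ) * τ + (1 + (r : ℂ) * n))) atTop
      (𝓝 (E2 τ)) := by
  have h := ((tendsto_inv_of_tendsto_norm_atTop (tendsto_norm_denom_seq hn τ)).const_mul
    ((-(2 * (π : ℂ) * Complex.I) / (2 * riemannZeta 2)) * (n : ℂ))).const_add (E2 τ)
  rw [mul_zero, add_zero] at h
  refine h.congr fun r => ?_
  ring

/-- `q(γ_r τ) → e^{2πi/n}`. [cite: Mahler1969, proof of Theorem 1 ((2))] -/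
theorem tendsto_cexp_smul_seq {n : ℕ} (hn : 1 ≤ n) (τ : ℍ) :
    Tendsto (fun r : ℕ => cexp (2 * π * Complex.I * (((τ : ℂ) + r) / ((n : ℂ) * τ + (1 + (r : ℂ) * n)))))
      atTop (𝓝 (cexp (2 * π * Complex.I / n))) := by
  have h := (continuous_exp.tendsto _).comp ((tendsto_smul_seq hn τ).const_mul (2 * π * Complex.I))
  have e : 2 * (π : ℂ) * Complex.I * (1 / (n : ℂ)) = 2 * π * Complex.I / n := by ring
  rw [e] at h
  exact h

/-! ### `E₄, E₆` are algebraically independent over `ℂ` -/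

/-- The weight of an exponent `(a, b)` for the weights `(2, 3)`. [folklore] -/
theorem mahler_weight_two_three (d : Fin 2 →₀ ℕ) :
    Finsupp.weight (![2, 3] : Fin 2 → ℕ) d = 2 * d 0 + 3 * d 1 := by
  rw [Finsupp.weight_apply, Finsupp.sum_fintype _ _ (by simp)]
  simp [Fin.sum_univ_two]
  ring

/-- The functions `(E₄, E₆)` as a sub-tuple of `(q, E₂, E₄, E₆)`. [folklore] -/
theorem mahler_pt4_comp_two_three (τ : ℍ) :
    (fun j => (![cexp (2 * π * Complex.I * τ), E2 τ, E₄ τ, E₆ τ] : Fin 4 → ℂ)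
      ((![2, 3] : Fin 2 → Fin 4) j)) = (![E₄ τ, E₆ τ] : Fin 2 → ℂ) := by
  funext j
  fin_cases j <;> rfl

/-- **The domain trick**: `E₄ · F(E₄, E₆) ≡ 0` on `ℍ` forces `F(E₄, E₆) ≡ 0`, because through the
bridge it is the formal identity `Q · F(Q, R) = 0` in the integral domain `ℂ⟦q⟧`.
[cite: NesterenkoPhilippon2001, Ch. 3 §1 (p. 27) and §3 3) (p. 32)] -/
theorem aeval_E₄_E₆_eq_zero_of_E₄_mul_eq_zero (F : MvPolynomial (Fin 2) ℂ)
    (h : ∀ τ : ℍ, E₄ τ * aeval (![E₄ τ, E₆ τ] : Fin 2 → ℂ) F = 0) (τ : ℍ) :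
    aeval (![E₄ τ, E₆ τ] : Fin 2 → ℂ) F = 0 := by
  have hformal : ramanujanComposite (rename (![2, 3] : Fin 2 → Fin 4) (X 0 * F)) = 0 := by
    apply ramanujanComposite_rename_eq_zero_of_forall
    intro τ
    rw [mahler_pt4_comp_two_three, map_mul, aeval_X]
    simpa using h τ
  have hQ : ramanujanComposite (rename (![2, 3] : Fin 2 → Fin 4) (X 0 : MvPolynomial (Fin 2) ℂ)) ≠ 0 := by
    intro h0
    have := congrArg PowerSeries.constantCoeff h0
    rw [constantCoeff_ramanujanComposite, rename_X] at this
    simp at this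
  have hF : ramanujanComposite (rename (![2, 3] : Fin 2 → Fin 4) F) = 0 := by
    rw [map_mul] at hformal
    unfold ramanujanComposite at hformal hQ ⊢
    rw [map_mul] at hformal
    exact (mul_eq_zero.mp hformal).resolve_left hQ
  have := aeval_cexp_rename_eq_zero_of_ramanujanComposite_eq_zero _ hF τ
  rwa [mahler_pt4_comp_two_three] at this

/-- **`E₄, E₆` algebraically independent — isobaric case**, by induction on the weight: an
isobaric `F ∈ ℂ[x, y]` (weights `2, 3`) with `F(E₄, E₆) ≡ 0` is zero.
[cite: NesterenkoPhilippon2001, Ch. 1 Prop. 1.1 iii) (weight argument)] -/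
theorem eq_zero_of_isWeightedHomogeneous_of_forall_aeval_E₄_E₆_eq_zero (W : ℕ) :
    ∀ F : MvPolynomial (Fin 2) ℂ, IsWeightedHomogeneous (![2, 3] : Fin 2 → ℕ) F W →
      (∀ τ : ℍ, aeval (![E₄ τ, E₆ τ] : Fin 2 → ℂ) F = 0) → F = 0 := by
  induction W using Nat.strong_induction_on with
  | _ W ih => ?_
  intro F hF h
  by_contra hne
  set F1 := F.divMonomial (Finsupp.single 0 1) with hF1
  set F0 := F.modMonomial (Finsupp.single 0 1) with hF0
  have hsplit : X 0 * F1 + F0 = F := divMonomial_add_modMonomial_single F 0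
  -- the `x`-free part `F0` is `c · y^{W/3}`
  have hF0supp : ∀ d, coeff d F0 ≠ 0 → d = Finsupp.single 1 (W / 3) := by
    intro d hd
    have hnot : ¬ Finsupp.single (0 : Fin 2) 1 ≤ d := fun hle =>
      hd (coeff_modMonomial_of_le F hle)
    rw [coeff_modMonomial_of_not_le F hnot] at hd
    have hw := hF hd
    rw [mahler_weight_two_three] at hw
    rw [Finsupp.single_le_iff, not_le, Nat.lt_one_iff] at hnot
    ext i
    fin_cases i
    · simpa using hnot
    · simp only [Fin.mk_one, Finsupp.single_eq_same]
      omega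
  have hF0 : F0 = 0 := by
    by_contra hF0ne
    obtain ⟨d, hd⟩ := ne_zero_iff.mp hF0ne
    have hdeq := hF0supp d hd
    have hsub : F0.support ⊆ {Finsupp.single 1 (W / 3)} := fun e he =>
      Finset.mem_singleton.mpr (hF0supp e (mem_support_iff.mp he))
    have hmono : F0 = monomial (Finsupp.single 1 (W / 3)) (coeff (Finsupp.single 1 (W / 3)) F0) := by
      conv_lhs => rw [F0.as_sum]
      rw [Finset.sum_subset hsub, Finset.sum_singleton]
      intro e _ he
      rw [notMem_support_iff.mp he, map_zero]
    have hρ := h ρ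
    rw [← hsplit, map_add, map_mul, aeval_X] at hρ
    have e0 : (![E₄ ρ, E₆ ρ] : Fin 2 → ℂ) 0 = 0 := by
      simp [Literature.NumberTheory.EllipticCurves.ModularForms.E₄_rho]
    rw [e0, zero_mul, zero_add, hmono, aeval_monomial, Finsupp.prod_single_index (by simp)] at hρ
    have e1 : (![E₄ ρ, E₆ ρ] : Fin 2 → ℂ) 1 = E₆ ρ := rfl
    rw [e1] at hρ
    rcases mul_eq_zero.mp hρ with hc | hp
    · rw [hdeq] at hd
      exact hd (by simpa using hc)
    · exact absurd hp (pow_ne_zero _ Literature.NumberTheory.EllipticCurves.ModularForms.E₆_rho_ne_zero)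
  -- hence `F = x · F1`, `F1 ≠ 0` isobaric of weight `W - 2`, vanishing on `(E₄, E₆)`
  have hF1ne : F1 ≠ 0 := fun h0 => hne (by rw [← hsplit, h0, hF0, mul_zero, add_zero])
  have hwt : ∀ d, coeff d F1 ≠ 0 → 2 + Finsupp.weight (![2, 3] : Fin 2 → ℕ) d = W := by
    intro d hd
    rw [hF1, coeff_divMonomial] at hd
    have hw := hF hd
    rw [mahler_weight_two_three] at hw ⊢
    rw [Finsupp.add_apply, Finsupp.add_apply, Finsupp.single_eq_same, Finsupp.single_apply,
      if_neg (by decide)] at hw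
    omega
  have hW2 : 2 ≤ W := by
    obtain ⟨d, hd⟩ := ne_zero_iff.mp hF1ne
    have := hwt d hd
    omega
  have hF1iso : IsWeightedHomogeneous (![2, 3] : Fin 2 → ℕ) F1 (W - 2) := by
    intro d hd
    have := hwt d hd
    omega
  have hF1van : ∀ τ : ℍ, aeval (![E₄ τ, E₆ τ] : Fin 2 → ℂ) F1 = 0 := by
    apply aeval_E₄_E₆_eq_zero_of_E₄_mul_eq_zero
    intro τ
    have := h τ
    rw [← hsplit, hF0, add_zero, map_mul, aeval_X] at this
    simpa using this
  exact hF1ne (ih (W - 2) (by omega) F1 hF1iso hF1van)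

/-- **`E₄` and `E₆` are algebraically independent over `ℂ`**: `F(E₄, E₆) ≡ 0` on `ℍ` only for
`F = 0`. [cite: NesterenkoPhilippon2001, Ch. 1 Prop. 1.1 iii)] -/
theorem eq_zero_of_forall_aeval_E₄_E₆_eq_zero (F : MvPolynomial (Fin 2) ℂ)
    (h : ∀ τ : ℍ, aeval (![E₄ τ, E₆ τ] : Fin 2 → ℂ) F = 0) : F = 0 := by
  by_contra hF
  apply weightedHomogeneousComponent_top_ne_zero (![2, 3] : Fin 2 → ℕ) hF
  set W := F.weightedTotalDegree (![2, 3] : Fin 2 → ℕ) with hW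
  refine eq_zero_of_isWeightedHomogeneous_of_forall_aeval_E₄_E₆_eq_zero W _
    (weightedHomogeneousComponent_isWeightedHomogeneous W F) fun τ => ?_
  choose γ hγ using fun r : ℕ => exists_SL2Z_row (1 : ℕ) r
  have hden := fun r : ℕ =>
    denom_and_smul_of_entries (hγ r).1 (hγ r).2.1 (hγ r).2.2.1 (hγ r).2.2.2 τ
  rw [MvPolynomial.aeval_eq_eval]
  refine eval_weightedHomogeneousComponent_top_eq_zero_of_tendsto (![2, 3] : Fin 2 → ℕ) F
    (J := fun r => (denom (γ r) τ) ^ 2) (x := fun _ => (![E₄ τ, E₆ τ] : Fin 2 → ℂ)) ?_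
    tendsto_const_nhds ?_
  · have e : ∀ r : ℕ, ‖(((1 : ℕ) : ℂ) * τ + (1 + (r : ℂ) * (1 : ℕ))) ^ 2‖ = ‖(denom (γ r) τ) ^ 2‖ := by
      intro r
      rw [(hden r).1]
      push_cast
      ring_nf
    exact (tendsto_norm_denom_seq_sq (le_refl 1) τ).congr e
  · intro r
    have := h (γ r • τ)
    rw [MvPolynomial.aeval_eq_eval, mahler_pt2_smul] at this
    exact this

/-! ### `E₂, E₄, E₆` are algebraically independent over `ℂ` -/

/-- `τ + d ≠ 0` for `τ ∈ ℍ`, `d ∈ ℤ`. [folklore] -/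
theorem coe_add_intCast_ne_zero (τ : ℍ) (d : ℤ) : (τ : ℂ) + d ≠ 0 := by
  intro h0
  have := congrArg Complex.im h0
  simp at this
  exact τ.im_pos.ne' this

/-- The shifts `E₂(τ) + K/(τ + d)`, `d ∈ ℤ`, are pairwise distinct (`K ≠ 0`). [folklore] -/
theorem injective_E2_add_shift (τ : ℍ) :
    Function.Injective fun d : ℤ => E2 τ + (-(2 * (π : ℂ) * Complex.I) / (2 * riemannZeta 2)) / ((τ : ℂ) + d) := by
  intro d d' hdd
  have h1 : (-(2 * (π : ℂ) * Complex.I) / (2 * riemannZeta 2)) / ((τ : ℂ) + d) =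
      (-(2 * (π : ℂ) * Complex.I) / (2 * riemannZeta 2)) / ((τ : ℂ) + d') := add_left_cancel hdd
  rw [div_eq_div_iff (coe_add_intCast_ne_zero τ d) (coe_add_intCast_ne_zero τ d'),
    mul_right_inj' mahler_K_ne_zero] at h1
  have h2 : (d' : ℂ) = d := by linear_combination h1
  exact_mod_cast h2.symm

/-- **`E₂, E₄, E₆` are algebraically independent over `ℂ`**: `B(E₂, E₄, E₆) ≡ 0` on `ℍ` only for
`B = 0` (isobaric reduction, then the shifts `E₂ ↦ E₂ + K/(τ + d)` coming from
`[[1, d − 1], [1, d]] ∈ SL₂(ℤ)`, then the independence of `E₄, E₆`).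
[cite: NesterenkoPhilippon2001, Ch. 1 Prop. 1.1 iii)] [cite: Mahler1969, proof of Theorem 1] -/
theorem eq_zero_of_forall_aeval_E2_E₄_E₆_eq_zero (B : MvPolynomial (Fin 3) ℂ)
    (h : ∀ τ : ℍ, aeval (![E2 τ, E₄ τ, E₆ τ] : Fin 3 → ℂ) B = 0) : B = 0 := by
  by_contra hB
  set W := B.weightedTotalDegree (![1, 2, 3] : Fin 3 → ℕ) with hW
  set BW := weightedHomogeneousComponent (![1, 2, 3] : Fin 3 → ℕ) W B with hBW
  have hne : BW ≠ 0 := weightedHomogeneousComponent_top_ne_zero _ hB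
  have hiso : IsWeightedHomogeneous (![1, 2, 3] : Fin 3 → ℕ) BW W :=
    weightedHomogeneousComponent_isWeightedHomogeneous W B
  -- (1) the top component vanishes on `(E₂, E₄, E₆)`
  have hvan : ∀ τ : ℍ, eval (![E2 τ, E₄ τ, E₆ τ] : Fin 3 → ℂ) BW = 0 := by
    intro τ
    choose γ hγ using fun r : ℕ => exists_SL2Z_row (1 : ℕ) r
    have hden := fun r : ℕ =>
      denom_and_smul_of_entries (hγ r).1 (hγ r).2.1 (hγ r).2.2.1 (hγ r).2.2.2 τ
    refine eval_weightedHomogeneousComponent_top_eq_zero_of_tendsto (![1, 2, 3] : Fin 3 → ℕ) B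
      (J := fun r => (denom (γ r) τ) ^ 2)
      (x := fun r => (![E2 τ + (-(2 * (π : ℂ) * Complex.I) / (2 * riemannZeta 2)) * (((γ r) 1 0 : ℤ) : ℂ) / denom (γ r) τ,
        E₄ τ, E₆ τ] : Fin 3 → ℂ))
      ?_ ?_ ?_
    · have e : ∀ r : ℕ, ‖(((1 : ℕ) : ℂ) * τ + (1 + (r : ℂ) * (1 : ℕ))) ^ 2‖ = ‖(denom (γ r) τ) ^ 2‖ := by
        intro r
        rw [(hden r).1]
        push_cast
        ring_nf
      exact (tendsto_norm_denom_seq_sq (le_refl 1) τ).congr e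
    · rw [tendsto_pi_nhds]
      intro i
      fin_cases i
      · have e : ∀ r : ℕ, E2 τ + (-(2 * (π : ℂ) * Complex.I) / (2 * riemannZeta 2)) * ((1 : ℕ) : ℂ) / (((1 : ℕ) : ℂ) * τ + (1 + (r : ℂ) * (1 : ℕ))) =
            E2 τ + (-(2 * (π : ℂ) * Complex.I) / (2 * riemannZeta 2)) * (((γ r) 1 0 : ℤ) : ℂ) / denom (γ r) τ := by
          intro r
          rw [(hγ r).2.2.1, (hden r).1]
          push_cast
          ring_nf
        exact (tendsto_E2_add_div_denom_seq (le_refl 1) τ).congr e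
      · exact tendsto_const_nhds
      · exact tendsto_const_nhds
    · intro r
      have := h (γ r • τ)
      rw [MvPolynomial.aeval_eq_eval, mahler_pt3_smul] at this
      exact this
  -- (2) the shifts
  have hshift : ∀ (d : ℤ) (τ : ℍ),
      eval (![E2 τ + (-(2 * (π : ℂ) * Complex.I) / (2 * riemannZeta 2)) / ((τ : ℂ) + d), E₄ τ, E₆ τ] : Fin 3 → ℂ) BW = 0 := by
    intro d τ
    obtain ⟨γ, h00, h01, h10, h11⟩ := exists_SL2Z_row 1 (d - 1)
    have hd := (denom_and_smul_of_entries h00 h01 h10 h11 τ).1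
    have hJ : denom γ τ = (τ : ℂ) + d := by rw [hd]; push_cast; ring
    have hJne : denom γ τ ≠ 0 := denom_ne_zero _ _
    have := hvan (γ • τ)
    rw [mahler_pt3_smul γ τ, eval_scale_of_isWeightedHomogeneous _ hiso, h10, hJ] at this
    have := (mul_eq_zero.mp this).resolve_left (pow_ne_zero _ (pow_ne_zero _ (hJ ▸ hJne)))
    simpa using this
  -- (3) coefficients (polynomials in `E₄, E₆`) vanish, hence are zero
  have hcoef : ∀ (k : ℕ) (τ : ℍ),
      eval (![E₄ τ, E₆ τ] : Fin 2 → ℂ) ((finSuccEquiv ℂ 2 BW).coeff k) = 0 := by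
    intro k τ
    refine eval_coeff_finSuccEquiv_eq_zero BW _
      (Set.range fun d : ℤ => E2 τ + (-(2 * (π : ℂ) * Complex.I) / (2 * riemannZeta 2)) / ((τ : ℂ) + d))
      (Set.infinite_range_of_injective (injective_E2_add_shift τ)) ?_ k
    rintro _ ⟨d, rfl⟩
    exact hshift d τ
  have hzero : ∀ k, (finSuccEquiv ℂ 2 BW).coeff k = 0 := fun k =>
    eq_zero_of_forall_aeval_E₄_E₆_eq_zero _ fun τ => by rw [MvPolynomial.aeval_eq_eval]; exact hcoef k τ
  exact hne (eq_zero_of_forall_coeff_finSuccEquiv_eq_zero hzero)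

/-! ### Mahler's theorem -/

/-- The roots of unity `e^{2πi/(m+1)}`, `m ∈ ℕ`, are pairwise distinct. [folklore] -/
theorem injective_cexp_two_pi_I_div_succ :
    Function.Injective fun m : ℕ => cexp (2 * π * Complex.I / ((m + 1 : ℕ) : ℂ)) := by
  intro m m' h
  have hm := Complex.isPrimitiveRoot_exp (m + 1) (Nat.succ_ne_zero m)
  have hm' := Complex.isPrimitiveRoot_exp (m' + 1) (Nat.succ_ne_zero m')
  have h' : cexp (2 * π * Complex.I / ((m + 1 : ℕ) : ℂ)) = cexp (2 * π * Complex.I / ((m' + 1 : ℕ) : ℂ)) := h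
  rw [h'] at hm
  have := hm.unique hm'
  omega

/-- **Mahler's theorem** [Mah1, Theorem 1] in the form used in LNM 1752 Ch. 3 §3 3), Ch. 10 §5:
`z, P(z), Q(z), R(z)` are algebraically independent over `ℂ`, i.e. `A(z, P, Q, R) ≠ 0` in `ℂ⟦z⟧`
for every non-zero `A ∈ ℂ[z, x₁, x₂, x₃]`. Discharges `Mahler1969_ramanujan_algIndep`.
[cite: Mahler1969, Theorem 1] [cite: NesterenkoPhilippon2001, Ch. 10 §1 Example 3 (p. 151), §5 (p. 163); Ch. 3 §3 3) (p. 32); Ch. 1 Prop. 1.1 iii)] -/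
theorem Mahler1969_ramanujan_algIndep_holds : Mahler1969_ramanujan_algIndep := by
  intro A hA hcomp
  have hvanA := aeval_cexp_eq_zero_of_ramanujanComposite_eq_zero hcomp
  set W := A.weightedTotalDegree (![0, 1, 2, 3] : Fin 4 → ℕ) with hW
  set AW := weightedHomogeneousComponent (![0, 1, 2, 3] : Fin 4 → ℕ) W A with hAW
  have hne : AW ≠ 0 := weightedHomogeneousComponent_top_ne_zero _ hA
  -- (1) `A_W(e^{2πi/n}, E₂, E₄, E₆) ≡ 0` for every `n ≥ 1`
  have hlim : ∀ n : ℕ, 1 ≤ n → ∀ τ : ℍ,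
      eval (![cexp (2 * π * Complex.I / n), E2 τ, E₄ τ, E₆ τ] : Fin 4 → ℂ) AW = 0 := by
    intro n hn τ
    choose γ hγ using fun r : ℕ => exists_SL2Z_row (n : ℕ) r
    have hden := fun r : ℕ =>
      denom_and_smul_of_entries (hγ r).1 (hγ r).2.1 (hγ r).2.2.1 (hγ r).2.2.2 τ
    refine eval_weightedHomogeneousComponent_top_eq_zero_of_tendsto (![0, 1, 2, 3] : Fin 4 → ℕ) A
      (J := fun r => (denom (γ r) τ) ^ 2)
      (x := fun r => (![cexp (2 * π * Complex.I * (↑(γ r • τ) : ℂ)),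
        E2 τ + (-(2 * (π : ℂ) * Complex.I) / (2 * riemannZeta 2)) * (((γ r) 1 0 : ℤ) : ℂ) / denom (γ r) τ, E₄ τ, E₆ τ] : Fin 4 → ℂ)) ?_ ?_ ?_
    · have e : ∀ r : ℕ, ‖((n : ℂ) * τ + (1 + (r : ℂ) * n)) ^ 2‖ = ‖(denom (γ r) τ) ^ 2‖ := by
        intro r
        rw [(hden r).1]
        push_cast
        ring_nf
      exact (tendsto_norm_denom_seq_sq hn τ).congr e
    · rw [tendsto_pi_nhds]
      intro i
      fin_cases i
      · have e : ∀ r : ℕ,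
            cexp (2 * π * Complex.I * (((τ : ℂ) + r) / ((n : ℂ) * τ + (1 + (r : ℂ) * n)))) =
              cexp (2 * π * Complex.I * (↑(γ r • τ) : ℂ)) := by
          intro r
          rw [(hden r).2]
          push_cast
          ring_nf
        exact (tendsto_cexp_smul_seq hn τ).congr e
      · have e : ∀ r : ℕ, E2 τ + (-(2 * (π : ℂ) * Complex.I) / (2 * riemannZeta 2)) * (n : ℂ) / ((n : ℂ) * τ + (1 + (r : ℂ) * n)) =
            E2 τ + (-(2 * (π : ℂ) * Complex.I) / (2 * riemannZeta 2)) * (((γ r) 1 0 : ℤ) : ℂ) / denom (γ r) τ := by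
          intro r
          rw [(hγ r).2.2.1, (hden r).1]
          push_cast
          ring_nf
        exact (tendsto_E2_add_div_denom_seq hn τ).congr e
      · exact tendsto_const_nhds
      · exact tendsto_const_nhds
    · intro r
      have := hvanA (γ r • τ)
      rw [MvPolynomial.aeval_eq_eval, mahler_pt4_smul] at this
      exact this
  -- (2) the coefficients of `A_W` in `z` (polynomials in `E₂, E₄, E₆`) vanish, hence are zero
  have hcoef : ∀ (k : ℕ) (τ : ℍ),
      eval (![E2 τ, E₄ τ, E₆ τ] : Fin 3 → ℂ) ((finSuccEquiv ℂ 3 AW).coeff k) = 0 := by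
    intro k τ
    refine eval_coeff_finSuccEquiv_eq_zero AW _
      (Set.range fun m : ℕ => cexp (2 * π * Complex.I / ((m + 1 : ℕ) : ℂ)))
      (Set.infinite_range_of_injective injective_cexp_two_pi_I_div_succ) ?_ k
    rintro _ ⟨m, rfl⟩
    exact hlim (m + 1) (Nat.succ_pos m) τ
  have hzero : ∀ k, (finSuccEquiv ℂ 3 AW).coeff k = 0 := fun k =>
    eq_zero_of_forall_aeval_E2_E₄_E₆_eq_zero _ fun τ => by rw [MvPolynomial.aeval_eq_eval]; exact hcoef k τ
  exact hne (eq_zero_of_forall_coeff_finSuccEquiv_eq_zero hzero)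

/-- **LNM 1752 Ch. 10 Lemma 5.2, discharged**: the only non-zero principal prime `D`-stable ideals
of `ℂ[z, x₁, x₂, x₃]` are `(z)` and `(Δ)` (`ch10_lemma_5_2_of_mahler` fed with Mahler's theorem).
[cite: NesterenkoPhilippon2001, Ch. 10 Lemma 5.2 (pp. 162–163)] -/
theorem NesterenkoPhilippon2001_ch10_lemma_5_2_holds : NesterenkoPhilippon2001_ch10_lemma_5_2 :=
  ch10_lemma_5_2_of_mahler Mahler1969_ramanujan_algIndep_holds

/-- Property 3) of LNM 1752 Ch. 3 §3 as a statement about values: a non-zero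
`A ∈ ℂ[z, x₁, x₂, x₃]` does not vanish identically on `(z, P(z), Q(z), R(z))`, `0 < |z| < 1`.
[cite: NesterenkoPhilippon2001, Ch. 3 §3 3) (p. 32)] -/
theorem exists_aeval_ramanujanPoint_ne_zero {A : MvPolynomial (Fin 4) ℂ} (hA : A ≠ 0) :
    ∃ τ : ℍ, aeval (![cexp (2 * π * Complex.I * τ), E2 τ, E₄ τ, E₆ τ] : Fin 4 → ℂ) A ≠ 0 := by
  by_contra h
  have h' : ∀ τ : ℍ, aeval (![cexp (2 * π * Complex.I * τ), E2 τ, E₄ τ, E₆ τ] : Fin 4 → ℂ) A = 0 :=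
    fun τ => not_not.mp (not_exists.mp h τ)
  have := ramanujanComposite_rename_eq_zero_of_forall (id : Fin 4 → Fin 4) A (by simpa using h')
  rw [rename_id] at this
  exact Mahler1969_ramanujan_algIndep_holds A hA this

end Literature.Barriers.Schanuel

end
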